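import Mathlib.Analysis.SpecialFunctions.Pow.Real
import HarnessLib

/-!
# Crux `NestingRigidity`, line `pinch-resampling` (v4), stub S12: the single-linkage hierarchy of a gap sequence

Crux `Summit.CriticalPhenomena.CardyFormulaZ2.Theses.CardyMagicRigidity.NestingRigidity`
(stmt-CriticalPhenomena-4835), line `pinch-resampling` v4, stub S12 `stub_neckHookupCoarseZ2 : NeckHookupCoarseZ2`.
First COMBINATORIAL brick of the summation of the necklace bound `ZNodeAbsBoundChainA`
(`…NeckZ2ErrorCoverChain`; plan in the module docstring of `…NeckZ2NodeReimerSpatial`, items (1)–(2)), as pure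
combinatorics over a finite sequence of reals — no percolation, no lattice.  Sequel: `…NestingRigidityGapEntropy`
(the gap-entropy inequality along this hierarchy).

**Setting.**  `N + 1` points `0, 1, …, N` on a line in this order, consecutive ones separated by the GAPS
`g 0, …, g (N - 1)` (the occupied cells of the inner layer in rank-free, spatial order, unrolled, in units of the
resolution); the index interval `[i, j]` has SPAN (diameter) `span g i j = Σ_{i ≤ m < j} g m`.

* `GapHierarchy.IsNode N g i j` — `[i, j]` is a single-linkage cluster: every inner gap is smaller than the two
  boundary gaps `g (i - 1)` (if `0 < i`) and `g j` (if `j < N`); `IsPreNode` is the non-strict version (the intervals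
  met by the Cartesian-tree recursion).  Leaves `[i, i]` and the root `[0, N]` are nodes.
* The OUTER GAP `gapOut N g i j` is the smaller existing boundary gap (for the root, by convention, the value `g N`, at
  the user's disposal) and the RATIO is `ratio N g i j = gapOut / (span + 1)`.  For the geometry of node annuli (outer
  radius `≍ gapOut`, inner radius `≍ span`): the outer gap of an interval is at most the span of any strictly larger
  interval (`gapOut_le_span_of_lt`: a sub-node's annulus sits inside the inner disc of every ancestor), and two
  intervals `[i, j] < [i', j']` are at distance `span g j i' ≥` both outer gaps (`gapOut_le_span_between`: annuli of
  disjoint nodes are disjoint).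
* `GapHierarchy.isNode_laminar`: nodes form a LAMINAR family; `GapHierarchy.card_nodes_le`: there are at most
  `2 N + 1` of them (`N + 1` leaves, and a non-leaf node is recovered from any of its maximal inner gaps,
  `argmaxGap_injOn`) — registered anchor `gapHierarchy_laminar_card`.  In the summation this bounds the number of
  four-arm node factors (each carrying a non-explicit constant) linearly in the number of occupied cells.
-/

noncomputable section

namespace Summit.CriticalPhenomena.CardyFormulaZ2.Cruxes.NestingRigidity.PinchResampling

open Finset

namespace GapHierarchy

variable {N : ℕ} {g : ℕ → ℝ}

/-! ## §1 Nodes of a gap sequence -/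

/-- The SPAN of the index interval `[i, j]`: the sum of the gaps `g m`, `i ≤ m < j` (the distance between the points
`i` and `j`). -/
def span (g : ℕ → ℝ) (i j : ℕ) : ℝ := ∑ m ∈ Ico i j, g m

/-- `[i, j]` (with `i ≤ j ≤ N`) is a NODE of the single-linkage hierarchy of the gap sequence: every inner gap is smaller
than the boundary gap `g (i - 1)` (if `0 < i`) and than the boundary gap `g j` (if `j < N`). -/
def IsNode (N : ℕ) (g : ℕ → ℝ) (i j : ℕ) : Prop :=
  i ≤ j ∧ j ≤ N ∧ ∀ m, i ≤ m → m < j → (0 < i → g m < g (i - 1)) ∧ (j < N → g m < g j)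

/-- `[i, j]` is a PRE-NODE: as `IsNode` with non-strict inequalities (the intervals met by the Cartesian-tree recursion). -/
def IsPreNode (N : ℕ) (g : ℕ → ℝ) (i j : ℕ) : Prop :=
  i ≤ j ∧ j ≤ N ∧ ∀ m, i ≤ m → m < j → (0 < i → g m ≤ g (i - 1)) ∧ (j < N → g m ≤ g j)

/-- The OUTER GAP of `[i, j]`: the smaller of the existing boundary gaps `g (i - 1)` (`0 < i`) and `g j` (`j < N`); for the
root `[0, N]` this is the conventional value `g N`. -/
def gapOut (N : ℕ) (g : ℕ → ℝ) (i j : ℕ) : ℝ :=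
  if 0 < i then (if j < N then min (g (i - 1)) (g j) else g (i - 1)) else g j

/-- The RATIO of `[i, j]`: outer gap over (span `+ 1`). -/
def ratio (N : ℕ) (g : ℕ → ℝ) (i j : ℕ) : ℝ := gapOut N g i j / (span g i j + 1)

open scoped Classical in
/-- The finite set of nodes, as pairs `(i, j)`. -/
def nodes (N : ℕ) (g : ℕ → ℝ) : Finset (ℕ × ℕ) :=
  (range (N + 1) ×ˢ range (N + 1)).filter fun q ↦ IsNode N g q.1 q.2

/-- Membership in `nodes`. -/
theorem mem_nodes {q : ℕ × ℕ} : q ∈ nodes N g ↔ IsNode N g q.1 q.2 := by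
  classical
  simp only [nodes, mem_filter, mem_product, mem_range, and_iff_right_iff_imp]
  exact fun h ↦ ⟨by have := h.1; have := h.2.1; omega, by have := h.2.1; omega⟩

/-- A node is a pre-node. -/
theorem IsNode.isPreNode {i j : ℕ} (h : IsNode N g i j) : IsPreNode N g i j :=
  ⟨h.1, h.2.1, fun m him hmj ↦ ⟨fun hi ↦ ((h.2.2 m him hmj).1 hi).le, fun hj ↦ ((h.2.2 m him hmj).2 hj).le⟩⟩

/-- Leaves are nodes. -/
theorem isNode_self {i : ℕ} (hi : i ≤ N) : IsNode N g i i :=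
  ⟨le_rfl, hi, fun m him hmi ↦ by omega⟩

/-- The root is a node. -/
theorem isNode_root : IsNode N g 0 N :=
  ⟨Nat.zero_le N, le_rfl, fun _ _ _ ↦ ⟨fun h ↦ absurd h (lt_irrefl 0), fun h ↦ absurd h (lt_irrefl N)⟩⟩

/-- The root is a pre-node. -/
theorem isPreNode_root : IsPreNode N g 0 N := isNode_root.isPreNode

/-- The span is nonnegative if the gaps are. -/
theorem span_nonneg (hg : ∀ m < N, 0 ≤ g m) {i j : ℕ} (hj : j ≤ N) : 0 ≤ span g i j :=
  sum_nonneg fun m hm ↦ hg m (by have := (mem_Ico.1 hm).2; omega)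

/-- A single gap is at most the span of an interval containing it. -/
theorem le_span_of_mem (hg : ∀ m < N, 0 ≤ g m) {i j m : ℕ} (hj : j ≤ N) (him : i ≤ m) (hmj : m < j) :
    g m ≤ span g i j :=
  single_le_sum (f := g) (fun m' hm' ↦ hg m' (by have := (mem_Ico.1 hm').2; omega)) (mem_Ico.2 ⟨him, hmj⟩)

/-- Spans add along consecutive intervals. -/
theorem span_add_span {i m j : ℕ} (him : i ≤ m) (hmj : m ≤ j) : span g i m + span g m j = span g i j :=
  sum_Ico_consecutive g him hmj

/-- The span of `[m, j]` splits off its first gap. -/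
theorem span_eq_add {m j : ℕ} (hmj : m < j) : span g m j = g m + span g (m + 1) j :=
  sum_eq_sum_Ico_succ_bot hmj g

/-- **Nodes form a laminar family**: two nodes are disjoint or nested. -/
theorem isNode_laminar {i j i' j' : ℕ} (h : IsNode N g i j) (h' : IsNode N g i' j') :
    (j < i' ∨ j' < i) ∨ (i ≤ i' ∧ j' ≤ j) ∨ (i' ≤ i ∧ j ≤ j') := by
  by_contra hcon
  have h1 : i' ≤ j := by by_contra hh; exact hcon (Or.inl (Or.inl (by omega)))
  have h2 : i ≤ j' := by by_contra hh; exact hcon (Or.inl (Or.inr (by omega)))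
  have h3 : ¬ (i ≤ i' ∧ j' ≤ j) := fun hh ↦ hcon (Or.inr (Or.inl hh))
  have h4 : ¬ (i' ≤ i ∧ j ≤ j') := fun hh ↦ hcon (Or.inr (Or.inr hh))
  obtain ⟨-, hjN, hn⟩ := h
  obtain ⟨-, hjN', hn'⟩ := h'
  -- either `i < i' ≤ j < j'` or `i' < i ≤ j' < j`
  rcases lt_or_ge i i' with hii | hii
  · have hjj : j < j' := by omega
    -- gap `j` is inner to `[i', j']`, gap `i' - 1` is inner to `[i, j]`
    have a := (hn' j h1 hjj).1 (by omega)
    have b := (hn (i' - 1) (by omega) (by omega)).2 (by omega)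
    exact absurd (a.trans b) (lt_irrefl _)
  · have hii' : i' < i := by omega
    have hjj : j' < j := by omega
    have a := (hn j' h2 hjj).1 (by omega)
    have b := (hn' (i - 1) (by omega) (by omega)).2 (by omega)
    exact absurd (a.trans b) (lt_irrefl _)

/-- **The outer gap of a node is at most the span of any strictly larger interval** (used for nesting node annuli: a
sub-node's annulus, of outer radius `≍ gapOut`, sits inside the inner disc, of radius `≍ span`, of every ancestor). -/
theorem gapOut_le_span_of_lt (hg : ∀ m < N, 0 ≤ g m) {i j i' j' : ℕ} (hij : i ≤ j) (hi : i' ≤ i) (hj : j ≤ j')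
    (hj' : j' ≤ N) (hne : (i', j') ≠ (i, j)) : gapOut N g i j ≤ span g i' j' := by
  unfold gapOut
  have hcases : i' < i ∨ j < j' := by
    by_contra hh
    exact hne (by rw [show i' = i by omega, show j' = j by omega])
  rcases hcases with hlt | hlt
  · have hi0 : 0 < i := by omega
    rw [if_pos hi0]
    have key : g (i - 1) ≤ span g i' j' := le_span_of_mem hg hj' (by omega) (by omega)
    by_cases hjN : j < N
    · rw [if_pos hjN]
      exact (min_le_left _ _).trans key
    · rw [if_neg hjN]
      exact key
  · have hjN : j < N := by omega
    have key : g j ≤ span g i' j' := le_span_of_mem hg hj' (by omega) hlt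
    by_cases hi0 : 0 < i
    · rw [if_pos hi0, if_pos hjN]
      exact (min_le_right _ _).trans key
    · rw [if_neg hi0]
      exact key

/-- **Disjoint intervals are far apart**: if `[i, j]` lies to the left of `[i', j']` (`j < i'`, `j' ≤ N`) then both outer
gaps are at most the distance `span g j i'` between the two intervals. -/
theorem gapOut_le_span_between (hg : ∀ m < N, 0 ≤ g m) {i j i' j' : ℕ} (hji : j < i') (hj' : i' ≤ N) :
    gapOut N g i j ≤ span g j i' ∧ gapOut N g i' j' ≤ span g j i' := by
  have hjN : j < N := by omega
  have h1 : g j ≤ span g j i' := le_span_of_mem hg hj' le_rfl hji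
  have h2 : g (i' - 1) ≤ span g j i' := le_span_of_mem hg hj' (by omega) (by omega)
  refine ⟨?_, ?_⟩
  · unfold gapOut
    by_cases hi0 : 0 < i
    · rw [if_pos hi0, if_pos hjN]
      exact (min_le_right _ _).trans h1
    · rw [if_neg hi0]
      exact h1
  · unfold gapOut
    rw [if_pos (show 0 < i' by omega)]
    by_cases hjN' : j' < N
    · rw [if_pos hjN']
      exact (min_le_left _ _).trans h2
    · rw [if_neg hjN']
      exact h2

/-! ### Counting the nodes -/

/-- A maximal inner gap of a non-leaf interval (some fixed choice; `0` for a leaf). -/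
def argmaxGap (g : ℕ → ℝ) (i j : ℕ) : ℕ :=
  if h : i < j then Classical.choose (exists_max_image (Ico i j) g ⟨i, mem_Ico.2 ⟨le_rfl, h⟩⟩) else 0

/-- The chosen maximal inner gap lies inside the interval and is maximal. -/
theorem argmaxGap_spec {i j : ℕ} (h : i < j) :
    argmaxGap g i j ∈ Ico i j ∧ ∀ m ∈ Ico i j, g m ≤ g (argmaxGap g i j) := by
  unfold argmaxGap
  rw [dif_pos h]
  obtain ⟨hm, hmax⟩ := Classical.choose_spec (exists_max_image (Ico i j) g ⟨i, mem_Ico.2 ⟨le_rfl, h⟩⟩)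
  exact ⟨hm, hmax⟩

/-- **A non-leaf node is determined by any of its maximal inner gaps**: `argmaxGap` is injective on non-leaf nodes. -/
theorem argmaxGap_injOn :
    Set.InjOn (fun q : ℕ × ℕ ↦ argmaxGap g q.1 q.2) {q | q ∈ (nodes N g).filter fun q ↦ q.1 < q.2} := by
  rintro ⟨i, j⟩ hq ⟨i', j'⟩ hq' heq
  simp only [Set.mem_setOf_eq, mem_filter, mem_nodes] at hq hq'
  simp only at heq
  obtain ⟨hn, hij⟩ := hq
  obtain ⟨hn', hij'⟩ := hq'
  obtain ⟨hm, hmax⟩ := argmaxGap_spec (g := g) hij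
  obtain ⟨hm', hmax'⟩ := argmaxGap_spec (g := g) hij'
  rw [heq] at hm hmax
  set m := argmaxGap g i' j' with hmdef
  rw [mem_Ico] at hm hm'
  -- the two nodes share the gap `m`, hence are nested; a strictly larger one has a larger maximal gap
  rcases isNode_laminar hn hn' with (h | h) | ⟨h1, h2⟩ | ⟨h1, h2⟩
  · omega
  · omega
  · -- `[i', j'] ⊆ [i, j]`
    by_contra hne
    have hne' : i < i' ∨ j' < j := by
      by_contra hh
      exact hne (by rw [show i = i' by omega, show j = j' by omega])
    rcases hne' with hlt | hlt
    · have a := (hn'.2.2 m hm'.1 hm'.2).1 (by omega)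
      have b := hmax (i' - 1) (mem_Ico.2 ⟨by omega, by omega⟩)
      exact absurd (a.trans_le b) (lt_irrefl _)
    · have a := (hn'.2.2 m hm'.1 hm'.2).2 (by have := hn.2.1; omega)
      have b := hmax j' (mem_Ico.2 ⟨by omega, hlt⟩)
      exact absurd (a.trans_le b) (lt_irrefl _)
  · -- `[i, j] ⊆ [i', j']`
    by_contra hne
    have hne' : i' < i ∨ j < j' := by
      by_contra hh
      exact hne (by rw [show i = i' by omega, show j = j' by omega])
    rcases hne' with hlt | hlt
    · have a := (hn.2.2 m hm.1 hm.2).1 (by omega)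
      have b := hmax' (i - 1) (mem_Ico.2 ⟨by omega, by omega⟩)
      exact absurd (a.trans_le b) (lt_irrefl _)
    · have a := (hn.2.2 m hm.1 hm.2).2 (by have := hn'.2.1; omega)
      have b := hmax' j (mem_Ico.2 ⟨by omega, hlt⟩)
      exact absurd (a.trans_le b) (lt_irrefl _)

/-- **There are at most `2 N + 1` nodes** (`N + 1` leaves, and at most `N` non-leaf nodes, one per maximal gap). -/
theorem card_nodes_le : (nodes N g).card ≤ 2 * N + 1 := by
  classical
  have hsplit : nodes N g = (nodes N g).filter (fun q ↦ q.1 < q.2) ∪ (nodes N g).filter (fun q ↦ ¬ q.1 < q.2) :=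
    (filter_union_filter_not_eq _ _).symm
  have h1 : ((nodes N g).filter fun q ↦ q.1 < q.2).card ≤ N := by
    calc ((nodes N g).filter fun q ↦ q.1 < q.2).card ≤ (range N).card :=
          card_le_card_of_injOn (fun q ↦ argmaxGap g q.1 q.2) (fun q hq ↦ by
            simp only [coe_filter, Set.mem_setOf_eq, mem_nodes] at hq
            have := (argmaxGap_spec (g := g) hq.2).1
            rw [mem_Ico] at this
            simp only [coe_range, Set.mem_Iio]
            have := hq.1.2.1
            omega) argmaxGap_injOn
      _ = N := card_range N
  have h2 : ((nodes N g).filter fun q ↦ ¬ q.1 < q.2).card ≤ N + 1 := by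
    calc ((nodes N g).filter fun q ↦ ¬ q.1 < q.2).card ≤ ((range (N + 1)).image fun i ↦ (i, i)).card := by
          refine card_le_card fun q hq ↦ ?_
          simp only [mem_filter, mem_nodes, not_lt] at hq
          have heq : q.1 = q.2 := le_antisymm hq.1.1 hq.2
          refine mem_image.2 ⟨q.1, mem_range.2 (by have := hq.1.2.1; omega), ?_⟩
          rw [Prod.ext_iff]
          exact ⟨rfl, heq⟩
      _ ≤ (range (N + 1)).card := card_image_le
      _ = N + 1 := card_range _
  calc (nodes N g).card ≤ ((nodes N g).filter fun q ↦ q.1 < q.2).card +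
        ((nodes N g).filter fun q ↦ ¬ q.1 < q.2).card := by
        conv_lhs => rw [hsplit]
        exact card_union_le _ _
    _ ≤ N + (N + 1) := add_le_add h1 h2
    _ = 2 * N + 1 := by ring

end GapHierarchy

/-- **The single-linkage hierarchy of a gap sequence is laminar and has at most `2 N + 1` nodes (registered helper,
anchor of this module on the crux item)** (`GapHierarchy.isNode_laminar`, `GapHierarchy.card_nodes_le`). -/
theorem gapHierarchy_laminar_card : ∀ (N : ℕ) (g : ℕ → ℝ), (∀ i j i' j' : ℕ, GapHierarchy.IsNode N g i j → GapHierarchy.IsNode N g i' j' → (j < i' ∨ j' < i) ∨ (i ≤ i' ∧ j' ≤ j) ∨ (i' ≤ i ∧ j ≤ j')) ∧ (GapHierarchy.nodes N g).card ≤ 2 * N + 1 :=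
  fun _ _ ↦ ⟨fun _ _ _ _ h h' ↦ GapHierarchy.isNode_laminar h h', GapHierarchy.card_nodes_le⟩

end Summit.CriticalPhenomena.CardyFormulaZ2.Cruxes.NestingRigidity.PinchResampling

end
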